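import Mathlib
import Summits.MatrixMultiplication.MatrixMultiplication.Theorems.SnSubsetDichotomyHyperoctahedralThresholdStubSameColourSupply

/-!
# `R`-free twin pre-pairs from colliding based words — the ℓ² (Cauchy–Schwarz) twin supply, part 1: the collision map
# (crux `HyperoctahedralThreshold`, stmt-MatrixMultiplication-10883, refutation line, open core `stub_poorRigidCore`;
# siege variation "twins ℓ² argument")

Three involutions `μ b` of `Fin n` act on the right, `x · g := g.foldl (fun v b => μ b v) x` (conventions of the line and of
the sibling files `…RotationIdentity`, `…StubSameColourSupply`, `…TwinSupply`).  A TWIN PRE-PAIR of length `m` is `(z; p, q)`: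
a cyclically reduced word `z` (`List.IsChain (· ≠ ·) (z ++ z)`) of length `m` and two DISTINCT fixed points `p ≠ q` of `z`,
i.e. a closed non-backtracking colour-walk of the rung graph of twin type; it is `R`-FREE when the `z`-trajectories of `p` and
`q` avoid the forbidden set `R`.  `TP_R(m)` denotes their number (ordered pairs), written out as a `Finset` card.

This file is the combinatorial heart of the counting twin supply (the supply inequality and the extraction of a scale are in
the sequel `…TwinPairSupplyScale`): a COLLISION is an ordered pair of `R`-avoiding based words `((x,y),g₁)`, `((x,y),g₂)` at the
same off-diagonal ordered pair, `g₁ ≠ g₂` reduced of length `k` (first letter `≠ c`), with the same two endpoints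
`x·g₁ = x·g₂`, `y·g₁ = y·g₂`.  If its longest common suffix has length `i` and its longest common prefix has length `j`, write
`gₗ = t ++ aₗ ++ s`; then `z := a₁ ++ a₂⁻¹` is cyclically reduced of length `2(k-i-j)` (`twinWord_isChain`: inside the blocks by
reducedness, at the middle junction by suffix maximality, at the wrap-around by prefix maximality), fixes `x·t` and `y·t`
(`twinWord_fix`), and every trajectory point of `x·t` under `z` is a trajectory point of `x` under `g₁` or `g₂`
(`twinWord_avoid`), so the twin pre-pair `(z; x·t, y·t)` is `R`-free; the collision is recovered from `(s, t, z, x·t, y·t)`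
(`collision_inverse_twin`).  Hence (`card_collisions_le`) the collisions with suffix/prefix lengths `(i, j)` number at most
`3^i · 3^j · TP_R(2(k-i-j))`.  Finite combinatorics; only `μ b * μ b = 1` is used; the word-action and word-counting lemmas of
`…StubSameColourSupply` (lead c3) are reused.  [folklore; this line]
-/

-- the project's summit namespace `Summit.MatrixMultiplication.MatrixMultiplication` repeats a component by design (D-0022)
set_option linter.dupNamespace false

namespace Summit.MatrixMultiplication.MatrixMultiplication.Theorems.HyperoctahedralThreshold.TwinPairSupply

open Finset

variable {n : ℕ}

/-! ### Word action: walking back part of the way -/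

/-- Walking back `r` steps from the endpoint of `w` lands on the trajectory point at time `|w| - r`. [folklore] -/
theorem foldl_reverse_take (μ : Fin 3 → Equiv.Perm (Fin n)) (hμ : ∀ b, μ b * μ b = 1) (w : List (Fin 3))
    (a : Fin n) {r : ℕ} (hr : r ≤ w.length) :
    (w.reverse.take r).foldl (fun v b => μ b v) (w.foldl (fun v b => μ b v) a) =
      (w.take (w.length - r)).foldl (fun v b => μ b v) a := by
  have h1 : w.reverse.take r = (w.drop (w.length - r)).reverse := by
    conv_lhs => rw [← List.take_append_drop (w.length - r) w]
    rw [List.reverse_append, List.take_left' (by rw [List.length_reverse, List.length_drop]; omega)]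
  have h2 : w.foldl (fun v b => μ b v) a =
      (w.drop (w.length - r)).foldl (fun v b => μ b v) ((w.take (w.length - r)).foldl (fun v b => μ b v) a) := by
    rw [← List.foldl_append, List.take_append_drop]
  rw [h1, h2, Supply.foldl_act_reverse μ hμ]

/-! ### Three blocks of a word: prefix of length `j`, middle, suffix of length `i` -/

/-- `g = g.take j ++ (middle block) ++ g.drop (k - i)` for `j ≤ k - i`. [folklore] -/
theorem three_blocks {α : Type*} (g : List α) {k i j : ℕ} (hj : j ≤ k - i) :
    g.take j ++ (g.take (k - i)).drop j ++ g.drop (k - i) = g := by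
  have h1 : g.take j = (g.take (k - i)).take j := by
    rw [List.take_take, Nat.min_eq_left hj]
  rw [h1, List.take_append_drop, List.take_append_drop]

/-- The prefix followed by the middle block is the head `g.take (k - i)`, for `j ≤ k - i`. [folklore] -/
theorem take_append_middle {α : Type*} (g : List α) {k i j : ℕ} (hj : j ≤ k - i) :
    g.take j ++ (g.take (k - i)).drop j = g.take (k - i) := by
  have h1 : g.take j = (g.take (k - i)).take j := by
    rw [List.take_take, Nat.min_eq_left hj]
  rw [h1, List.take_append_drop]

/-- The middle block has length `k - i - j`. [folklore] -/
theorem length_middle {α : Type*} (g : List α) {k i j : ℕ} (hl : g.length = k) :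
    ((g.take (k - i)).drop j).length = k - i - j := by
  rw [List.length_drop, List.length_take, hl]; omega

/-- The prefix followed by the first `r` letters of the middle block is the prefix of length `j + r`. [folklore] -/
theorem take_append_take_middle {α : Type*} (g : List α) {k i j r : ℕ} (hr : r ≤ k - i - j) :
    g.take j ++ ((g.take (k - i)).drop j).take r = g.take (j + r) := by
  rw [List.drop_take, List.take_take, Nat.min_eq_left hr, List.take_add]

/-! ### The twin pre-pair of a colliding pair of words -/

section Collision

variable (μ : Fin 3 → Equiv.Perm (Fin n)) {k i j : ℕ} {g₁ g₂ : List (Fin 3)}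

/-- The twin word `z = a₁ ++ a₂⁻¹` of a collision has length `2 (k - i - j)`. [folklore] -/
theorem twinWord_length (hl₁ : g₁.length = k) (hl₂ : g₂.length = k) :
    ((g₁.take (k - i)).drop j ++ ((g₂.take (k - i)).drop j).reverse).length = 2 * (k - i - j) := by
  rw [List.length_append, List.length_reverse, length_middle g₁ hl₁, length_middle g₂ hl₂]; ring

/-- Maximality of the common suffix: the last letters of the two heads `gₗ.take (k - i)` differ. [folklore] -/
theorem last_ne_of_suffix (hl₁ : g₁.length = k) (hl₂ : g₂.length = k)
    (hs : g₁.drop (k - i) = g₂.drop (k - i)) (hns : g₁.drop (k - (i + 1)) ≠ g₂.drop (k - (i + 1))) :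
    ∀ x ∈ (g₁.take (k - i)).getLast?, ∀ y ∈ (g₂.take (k - i)).getLast?, x ≠ y := by
  intro x hx y hy hxy
  subst hxy
  apply hns
  have e₁ : g₁ = (g₁.take (k - i)).dropLast ++ ([x] ++ g₁.drop (k - i)) := by
    rw [← List.append_assoc, List.dropLast_append_getLast? x hx, List.take_append_drop]
  have e₂ : g₂ = (g₂.take (k - i)).dropLast ++ ([x] ++ g₂.drop (k - i)) := by
    rw [← List.append_assoc, List.dropLast_append_getLast? x hy, List.take_append_drop]
  have d₁ : g₁.drop (k - (i + 1)) = [x] ++ g₁.drop (k - i) := by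
    conv_lhs => rw [e₁]
    exact List.drop_left' (by rw [List.length_dropLast, List.length_take, hl₁]; omega)
  have d₂ : g₂.drop (k - (i + 1)) = [x] ++ g₂.drop (k - i) := by
    conv_lhs => rw [e₂]
    exact List.drop_left' (by rw [List.length_dropLast, List.length_take, hl₂]; omega)
  rw [d₁, d₂, hs]

/-- Maximality of the common prefix: the letters at position `j` differ. [folklore] -/
theorem getElem?_ne_of_prefix (ht : g₁.take j = g₂.take j) (hnt : g₁.take (j + 1) ≠ g₂.take (j + 1)) :
    g₁[j]? ≠ g₂[j]? := by
  intro h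
  apply hnt
  rw [List.take_add_one, List.take_add_one, ht, h]

/-- The first letters of the two middle blocks differ, and both exist. [folklore] -/
theorem head_middle_ne (hj : j < k - i)
    (ht : g₁.take j = g₂.take j) (hnt : g₁.take (j + 1) ≠ g₂.take (j + 1)) :
    ∀ x ∈ ((g₂.take (k - i)).drop j).head?, ∀ y ∈ ((g₁.take (k - i)).drop j).head?, x ≠ y := by
  intro x hx y hy hxy
  rw [List.head?_drop, List.getElem?_take, if_pos hj] at hx hy
  exact getElem?_ne_of_prefix ht hnt (by rw [Option.mem_def.1 hx, Option.mem_def.1 hy, hxy])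

/-- **The twin word is cyclically reduced.**  With `aₗ` the middle blocks of two reduced words `g₁ ≠ g₂` of length `k` whose
longest common suffix has length `i` and longest common prefix has length `j`, the word `z = a₁ ++ a₂⁻¹` satisfies
`List.IsChain (· ≠ ·) (z ++ z)`: inside the blocks by reducedness, at the middle junction because the last letters of
`a₁, a₂` differ (suffix maximality), at the wrap-around because their first letters differ (prefix maximality). [folklore] -/
theorem twinWord_isChain (hj : j < k - i) (hl₁ : g₁.length = k) (hl₂ : g₂.length = k)
    (hc₁ : List.IsChain (· ≠ ·) g₁) (hc₂ : List.IsChain (· ≠ ·) g₂)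
    (hs : g₁.drop (k - i) = g₂.drop (k - i)) (hns : g₁.drop (k - (i + 1)) ≠ g₂.drop (k - (i + 1)))
    (ht : g₁.take j = g₂.take j) (hnt : g₁.take (j + 1) ≠ g₂.take (j + 1)) :
    List.IsChain (· ≠ ·)
      (((g₁.take (k - i)).drop j ++ ((g₂.take (k - i)).drop j).reverse) ++
        ((g₁.take (k - i)).drop j ++ ((g₂.take (k - i)).drop j).reverse)) := by
  set a₁ := (g₁.take (k - i)).drop j with ha₁
  set a₂ := (g₂.take (k - i)).drop j with ha₂
  have hl₁' : a₁.length = k - i - j := length_middle g₁ hl₁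
  have hl₂' : a₂.length = k - i - j := length_middle g₂ hl₂
  have hne₁ : a₁ ≠ [] := List.ne_nil_of_length_pos (by omega)
  have hne₂ : a₂ ≠ [] := List.ne_nil_of_length_pos (by omega)
  have hne₂' : a₂.reverse ≠ [] := by simpa using hne₂
  have hca₁ : List.IsChain (· ≠ ·) a₁ := (hc₁.take _).drop _
  have hca₂ : List.IsChain (· ≠ ·) a₂.reverse := by
    rw [List.isChain_reverse]; exact ((hc₂.take _).drop _).imp (fun x y hxy => Ne.symm hxy)
  -- last letters of the middle blocks are the last letters of the heads
  have hlast : ∀ x ∈ a₁.getLast?, ∀ y ∈ a₂.reverse.head?, x ≠ y := by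
    intro x hx y hy
    rw [List.head?_reverse, ha₂, List.getLast?_drop, if_neg (by rw [List.length_take, hl₂]; omega)] at hy
    rw [ha₁, List.getLast?_drop, if_neg (by rw [List.length_take, hl₁]; omega)] at hx
    exact last_ne_of_suffix hl₁ hl₂ hs hns x hx y hy
  have hz : List.IsChain (· ≠ ·) (a₁ ++ a₂.reverse) := List.IsChain.append hca₁ hca₂ hlast
  refine List.IsChain.append hz hz ?_
  intro x hx y hy
  rw [List.getLast?_append_of_ne_nil _ hne₂', List.getLast?_reverse] at hx
  rw [List.head?_append_of_ne_nil _ hne₁] at hy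
  exact head_middle_ne hj ht hnt x hx y hy

variable (hμ : ∀ b, μ b * μ b = 1)
include hμ

/-- Cancelling the common suffix: the two heads agree at `a`. [folklore] -/
theorem heads_agree {a : Fin n} (hs : g₁.drop (k - i) = g₂.drop (k - i))
    (he : g₁.foldl (fun v b => μ b v) a = g₂.foldl (fun v b => μ b v) a) :
    (g₁.take (k - i)).foldl (fun v b => μ b v) a = (g₂.take (k - i)).foldl (fun v b => μ b v) a := by
  rw [← List.take_append_drop (k - i) g₁, ← List.take_append_drop (k - i) g₂, List.foldl_append,
    List.foldl_append, hs] at he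
  exact Supply.foldl_act_injective μ hμ _ he

/-- **The twin word fixes the transported point.**  If `g₁, g₂` agree at `a`, then `z = a₁ ++ a₂⁻¹` fixes
`a · (g₁.take j)`. [folklore] -/
theorem twinWord_fix {a : Fin n} (hj : j ≤ k - i) (hs : g₁.drop (k - i) = g₂.drop (k - i))
    (ht : g₁.take j = g₂.take j) (he : g₁.foldl (fun v b => μ b v) a = g₂.foldl (fun v b => μ b v) a) :
    ((g₁.take (k - i)).drop j ++ ((g₂.take (k - i)).drop j).reverse).foldl (fun v b => μ b v)
        ((g₁.take j).foldl (fun v b => μ b v) a) = (g₁.take j).foldl (fun v b => μ b v) a := by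
  have h1 : ((g₁.take (k - i)).drop j).foldl (fun v b => μ b v) ((g₁.take j).foldl (fun v b => μ b v) a) =
      (g₁.take (k - i)).foldl (fun v b => μ b v) a := by
    rw [← List.foldl_append, take_append_middle g₁ hj]
  have h2 : ((g₂.take (k - i)).drop j).foldl (fun v b => μ b v) ((g₁.take j).foldl (fun v b => μ b v) a) =
      (g₂.take (k - i)).foldl (fun v b => μ b v) a := by
    rw [ht, ← List.foldl_append, take_append_middle g₂ hj]
  rw [List.foldl_append, h1, heads_agree μ hμ hs he, ← h2, Supply.foldl_act_reverse μ hμ]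

/-- **The twin pre-pair avoids what the two based words avoid.**  Every trajectory point of `a · (g₁.take j)` under
`z = a₁ ++ a₂⁻¹` is a trajectory point of `a` under `g₁` (first half) or under `g₂` (second half, walked backwards). [folklore] -/
theorem twinWord_avoid {a : Fin n} (R : Finset (Fin n)) (hj : j < k - i)
    (hl₁ : g₁.length = k) (hl₂ : g₂.length = k) (hs : g₁.drop (k - i) = g₂.drop (k - i))
    (he : g₁.foldl (fun v b => μ b v) a = g₂.foldl (fun v b => μ b v) a)
    (hR₁ : ∀ t : Fin (k + 1), (g₁.take (t : ℕ)).foldl (fun v b => μ b v) a ∉ R)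
    (hR₂ : ∀ t : Fin (k + 1), (g₂.take (t : ℕ)).foldl (fun v b => μ b v) a ∉ R) :
    ∀ r : Fin (2 * (k - i - j) + 1),
      (((g₁.take (k - i)).drop j ++ ((g₂.take (k - i)).drop j).reverse).take (r : ℕ)).foldl (fun v b => μ b v)
        ((g₁.take j).foldl (fun v b => μ b v) a) ∉ R := by
  intro r
  have hlm₁ : ((g₁.take (k - i)).drop j).length = k - i - j := length_middle g₁ hl₁
  have hlm₂ : ((g₂.take (k - i)).drop j).length = k - i - j := length_middle g₂ hl₂
  have hr2 : (r : ℕ) ≤ 2 * (k - i - j) := Nat.le_of_lt_succ r.isLt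
  by_cases hr : (r : ℕ) ≤ k - i - j
  · rw [List.take_append_of_le_length (by rw [hlm₁]; exact hr), ← List.foldl_append,
      take_append_take_middle g₁ hr]
    exact hR₁ ⟨j + r, by omega⟩
  · rw [not_le] at hr
    have hsplit : ((g₁.take (k - i)).drop j ++ ((g₂.take (k - i)).drop j).reverse).take (r : ℕ) =
        (g₁.take (k - i)).drop j ++ (((g₂.take (k - i)).drop j).reverse).take ((r : ℕ) - (k - i - j)) := by
      rw [List.take_append, List.take_of_length_le (by rw [hlm₁]; exact hr.le), hlm₁]
    have h1 : ((g₁.take (k - i)).drop j).foldl (fun v b => μ b v) ((g₁.take j).foldl (fun v b => μ b v) a) =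
        ((g₂.take (k - i)).drop j).foldl (fun v b => μ b v) ((g₂.take j).foldl (fun v b => μ b v) a) := by
      rw [← List.foldl_append, ← List.foldl_append, take_append_middle g₁ hj.le, take_append_middle g₂ hj.le]
      exact heads_agree μ hμ hs he
    rw [hsplit, List.foldl_append, h1, foldl_reverse_take μ hμ _ _ (by rw [hlm₂]; omega), hlm₂,
      ← List.foldl_append, take_append_take_middle g₂ (Nat.sub_le _ _)]
    exact hR₂ ⟨j + (k - i - j - ((r : ℕ) - (k - i - j))), by omega⟩

omit hμ in
/-- The colliding pair is recovered from the common prefix, the twin word and the common suffix. [folklore] -/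
theorem collision_inverse_twin (hj : j ≤ k - i) (hl₁ : g₁.length = k)
    (hs : g₁.drop (k - i) = g₂.drop (k - i)) (ht : g₁.take j = g₂.take j) :
    g₁.take j ++ ((g₁.take (k - i)).drop j ++ ((g₂.take (k - i)).drop j).reverse).take (k - i - j) ++
        g₁.drop (k - i) = g₁ ∧
      g₁.take j ++ (((g₁.take (k - i)).drop j ++ ((g₂.take (k - i)).drop j).reverse).drop (k - i - j)).reverse ++
        g₁.drop (k - i) = g₂ := by
  have hl : ((g₁.take (k - i)).drop j).length = k - i - j := length_middle g₁ hl₁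
  constructor
  · rw [List.take_left' hl]; exact three_blocks g₁ hj
  · rw [List.drop_left' hl, List.reverse_reverse, ht, hs]; exact three_blocks g₂ hj

end Collision

/-! ### Counting collisions -/

/-- **Collisions inject into (suffix, prefix, `R`-free twin pre-pair).**  Among the ordered pairs of `R`-avoiding based words
`(((x, y), g₁), ((x, y), g₂))` at the same off-diagonal pair with the same two endpoints and `g₁ ≠ g₂`, those whose longest
common suffix has length `i` and longest common prefix has length `j` number at most `3^i · 3^j · TP_R(2(k - i - j))`. [folklore] -/
theorem card_collisions_le (μ : Fin 3 → Equiv.Perm (Fin n)) (hμ : ∀ b, μ b * μ b = 1) (c : Fin 3)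
    (R : Finset (Fin n)) (k i j : ℕ) (hi : i < k) (hj : j < k - i) :
    ((((((Finset.univ : Finset (Fin n)).offDiag ×ˢ
        (((Finset.univ : Finset (List.Vector (Fin 3) k)).image (fun v => v.toList)).filter
          (fun g => List.IsChain (· ≠ ·) g ∧ g.head? ≠ some c))).filter
        (fun e => (∀ t : Fin (k + 1), (e.2.take (t : ℕ)).foldl (fun v b => μ b v) e.1.1 ∉ R) ∧
          (∀ t : Fin (k + 1), (e.2.take (t : ℕ)).foldl (fun v b => μ b v) e.1.2 ∉ R))) ×ˢ
        (((Finset.univ : Finset (Fin n)).offDiag ×ˢ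
        (((Finset.univ : Finset (List.Vector (Fin 3) k)).image (fun v => v.toList)).filter
          (fun g => List.IsChain (· ≠ ·) g ∧ g.head? ≠ some c))).filter
        (fun e => (∀ t : Fin (k + 1), (e.2.take (t : ℕ)).foldl (fun v b => μ b v) e.1.1 ∉ R) ∧
          (∀ t : Fin (k + 1), (e.2.take (t : ℕ)).foldl (fun v b => μ b v) e.1.2 ∉ R)))).filter
        (fun q => q.1 ≠ q.2 ∧ q.1.1 = q.2.1 ∧
          q.1.2.foldl (fun v b => μ b v) q.1.1.1 = q.2.2.foldl (fun v b => μ b v) q.2.1.1 ∧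
          q.1.2.foldl (fun v b => μ b v) q.1.1.2 = q.2.2.foldl (fun v b => μ b v) q.2.1.2)).filter
        (fun q => q.1.2.drop (k - i) = q.2.2.drop (k - i) ∧ q.1.2.drop (k - (i + 1)) ≠ q.2.2.drop (k - (i + 1)) ∧
          q.1.2.take j = q.2.2.take j ∧ q.1.2.take (j + 1) ≠ q.2.2.take (j + 1))).card ≤
    3 ^ i * (3 ^ j * (((((Finset.univ : Finset (List.Vector (Fin 3) (2 * (k - i - j)))).image (fun v => v.toList)).filter
          (fun z => List.IsChain (· ≠ ·) (z ++ z))) ×ˢ (Finset.univ : Finset (Fin n)).offDiag).filter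
        (fun e => e.1.foldl (fun v b => μ b v) e.2.1 = e.2.1 ∧ e.1.foldl (fun v b => μ b v) e.2.2 = e.2.2 ∧
          (∀ t : Fin (2 * (k - i - j) + 1), (e.1.take (t : ℕ)).foldl (fun v b => μ b v) e.2.1 ∉ R) ∧
          (∀ t : Fin (2 * (k - i - j) + 1), (e.1.take (t : ℕ)).foldl (fun v b => μ b v) e.2.2 ∉ R))).card) := by
  rw [← Supply.card_words i, ← Supply.card_words j, ← Finset.card_product, ← Finset.card_product]
  refine Finset.card_le_card_of_injOn
    (fun q => (q.1.2.drop (k - i), (q.1.2.take j,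
      ((q.1.2.take (k - i)).drop j ++ ((q.2.2.take (k - i)).drop j).reverse,
        ((q.1.2.take j).foldl (fun v b => μ b v) q.1.1.1, (q.1.2.take j).foldl (fun v b => μ b v) q.1.1.2))))) ?_ ?_
  · intro q hq
    rw [Finset.mem_coe, Finset.mem_filter, Finset.mem_filter, Finset.mem_product] at hq
    obtain ⟨⟨⟨hq₁, hq₂⟩, hne, hpair, hex, hey⟩, hs, hns, ht, hnt⟩ := hq
    rw [Finset.mem_filter, Finset.mem_product, Finset.mem_filter, Supply.mem_words, Finset.mem_offDiag] at hq₁ hq₂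
    obtain ⟨⟨⟨-, -, hxy⟩, hl₁, hc₁, -⟩, hRx₁, hRy₁⟩ := hq₁
    obtain ⟨⟨-, hl₂, hc₂, -⟩, hRx₂, hRy₂⟩ := hq₂
    rw [← hpair] at hex hey hRx₂ hRy₂
    rw [Finset.mem_coe, Finset.mem_product, Supply.mem_words, Finset.mem_product, Supply.mem_words,
      Finset.mem_filter, Finset.mem_product, Finset.mem_filter, Supply.mem_words, Finset.mem_offDiag]
    refine ⟨by rw [List.length_drop, hl₁]; omega, by rw [List.length_take, hl₁]; omega,
      ⟨⟨twinWord_length hl₁ hl₂, twinWord_isChain hj hl₁ hl₂ hc₁ hc₂ hs hns ht hnt⟩,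
        Finset.mem_univ _, Finset.mem_univ _, ?_⟩, ?_, ?_, ?_, ?_⟩
    · intro h; exact hxy (Supply.foldl_act_injective μ hμ _ h)
    · exact twinWord_fix μ hμ hj.le hs ht hex
    · exact twinWord_fix μ hμ hj.le hs ht hey
    · exact twinWord_avoid μ hμ R hj hl₁ hl₂ hs hex hRx₁ hRx₂
    · exact twinWord_avoid μ hμ R hj hl₁ hl₂ hs hey hRy₁ hRy₂
  · refine Set.LeftInvOn.injOn (f₁' := fun r =>
      (((r.2.1.reverse.foldl (fun v b => μ b v) r.2.2.2.1, r.2.1.reverse.foldl (fun v b => μ b v) r.2.2.2.2),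
          r.2.1 ++ r.2.2.1.take (k - i - j) ++ r.1),
        ((r.2.1.reverse.foldl (fun v b => μ b v) r.2.2.2.1, r.2.1.reverse.foldl (fun v b => μ b v) r.2.2.2.2),
          r.2.1 ++ (r.2.2.1.drop (k - i - j)).reverse ++ r.1))) ?_
    intro q hq
    rw [Finset.mem_coe, Finset.mem_filter, Finset.mem_filter, Finset.mem_product] at hq
    obtain ⟨⟨⟨hq₁, -⟩, -, hpair, -, -⟩, hs, -, ht, -⟩ := hq
    rw [Finset.mem_filter, Finset.mem_product, Finset.mem_filter, Supply.mem_words] at hq₁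
    obtain ⟨⟨-, hl₁, -, -⟩, -, -⟩ := hq₁
    obtain ⟨E1, E2⟩ := collision_inverse_twin (g₂ := q.2.2) hj.le hl₁ hs ht
    dsimp only
    rw [E1, E2, Supply.foldl_act_reverse μ hμ, Supply.foldl_act_reverse μ hμ]
    exact Prod.ext (Prod.ext Prod.mk.eta rfl) (Prod.ext (Prod.mk.eta.trans hpair) rfl)

/-- **Registered form** (`stub_twinPairCollisions`, a `--supports` sub-goal of crux `stmt-MatrixMultiplication-10883`):
`card_collisions_le`, fully quantified. -/
theorem stub_twinPairCollisions : ∀ (n k i j : ℕ) (μ : Fin 3 → Equiv.Perm (Fin n)) (c : Fin 3) (R : Finset (Fin n)), (∀ b, μ b * μ b = 1) → i < k → j < k - i → ((((((Finset.univ : Finset (Fin n)).offDiag ×ˢ (((Finset.univ : Finset (List.Vector (Fin 3) k)).image (fun v => v.toList)).filter (fun g => List.IsChain (· ≠ ·) g ∧ g.head? ≠ some c))).filter (fun e => (∀ t : Fin (k + 1), (e.2.take (t : ℕ)).foldl (fun v b => μ b v) e.1.1 ∉ R) ∧ (∀ t : Fin (k + 1), (e.2.take (t : ℕ)).foldl (fun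 v b => μ b v) e.1.2 ∉ R))) ×ˢ (((Finset.univ : Finset (Fin n)).offDiag ×ˢ (((Finset.univ : Finset (List.Vector (Fin 3) k)).image (fun v => v.toList)).filter (fun g => List.IsChain (· ≠ ·) g ∧ g.head? ≠ some c))).filter (fun e => (∀ t : Fin (k + 1), (e.2.take (t : ℕ)).foldl (fun v b => μ b v) e.1.1 ∉ R) ∧ (∀ t : Fin (k + 1), (e.2.take (t : ℕ)).foldl (fun v b => μ b v) e.1.2 ∉ R)))).filter (fun q => q.1 ≠ q.2 ∧ q.1.1 = q.2.1 ∧ q.1.2.foldl (fun v b => μ b v) q.1.1.1 = q.2.2.foldl (fun v b => μ b v) q.2.1.1 ∧ q.1.2.foldl (fun v b => μ b v) q.1.1.2 = q.2.2.foldl (fun v b => μ b v) q.2.1.2)).filter (fun q => q.1.2.drop (k - i) = q.2.2.drop (k - i) ∧ q.1.2.drop (k - (i + 1)) ≠ q.2.2.drop (k - (i + 1)) ∧ q.1.2.take j = q.2.2.take j ∧ q.1.2.take (j + 1) ≠ q.2.2.take (j + 1))).card ≤ 3 ^ i * (3 ^ j * (((((Finset.univ : Finset (List.Vector (Fin 3)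 (2 * (k - i - j)))).image (fun v => v.toList)).filter (fun z => List.IsChain (· ≠ ·) (z ++ z))) ×ˢ (Finset.univ : Finset (Fin n)).offDiag).filter (fun e => e.1.foldl (fun v b => μ b v) e.2.1 = e.2.1 ∧ e.1.foldl (fun v b => μ b v) e.2.2 = e.2.2 ∧ (∀ t : Fin (2 * (k - i - j) + 1), (e.1.take (t : ℕ)).foldl (fun v b => μ b v) e.2.1 ∉ R) ∧ (∀ t : Fin (2 * (k - i - j) + 1), (e.1.take (t : ℕ)).foldl (fun v b => μ b v) e.2.2 ∉ R))).card) :=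
  fun _ k i j μ c R hμ hi hj => card_collisions_le μ hμ c R k i j hi hj

end Summit.MatrixMultiplication.MatrixMultiplication.Theorems.HyperoctahedralThreshold.TwinPairSupply
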